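import Summits.ResolutionOfSingularities.ResolutionOfSingularities.Theorems.PurelyInseparableDim4SwapTransportWindowGlueSigma
import HarnessLib
import HarnessLib.Audit.Tags

/-!
# Purely inseparable four-folds — TRANSPORT CORE FOR EVERY σ = (n, n) + 0: one honest step of a twin-slot state of order `p + n` is
# shadowed by a virtual slot step, regime-free, slot case and rotation case (cell `res-dim4-pi`, K2(p) lane, B-LF (iii-b) class (iii),
# virtual port 1 ↦ n of the C∞ window, FILE C1 = W1b p713046 with `1 ↦ n`)

[OURS · counted 0 · cell `res-dim4-pi` · K2(p) lane (holder res-dim4-p-12 g5, ruling g5-21 (α)).]  Nothing here proves K2(p) for any `p`, any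
TAIL(p, d, 3), `NoIsolatedTrap p p` or resolution of singularities in dimension ≥ 4 / characteristic `p` — NOT proved.  AI kernel work,
weaker than expert review.  A transport lemma about OUR frame; kills nothing by itself.

W1b VERBATIM WITH `1 ↦ n`: the relation `B.F = clean_p(U^p · θ A.F) + E` (`E ∈ 𝔪^M`; slots `θ(x_{πλ}) = x_λ e_λ`, `θ(x_{πμ}) = x_μ e_μ`,
free letters `u, f` with invertible 2×2 linear block), real and virtual states of order `p + n` (`0 < n < p`) with twin weights
`n·x_{πλ} + n·x_{πμ}` / `n·x_λ + n·x_μ`; ONE honest step of the real chain (child certified isolated at `Nc`, order `p + n`, weights of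
degree `2n`, `e_G = eG`) is shadowed at precision `M ≥ Nc + 2p + n + 1` by the virtual slot step with the Cramer translation `b′`; the
relation is returned at precision `M − p` with the SAME shape, and the virtual child has order `p + n`, twin weights, `x^r ∣ F`, isolation
and `e_G = eG` (engine: `unitFrame_step₂` / `unitFrame_rotate₂`, `read_of_rel₂` at `o = p + n` (`p ∤ p + n`), G1 `eG_transfer_sigma0`,
`step_cases_of_weights_sigma0`, `step_r_pair_of_slot_sigma0`).
* §1 **`virtual_core_slot_sigma0`** — real chart = a slot `π λ`: then `b (π μ) = 0`, the real child keeps `n·x_{πλ} + n·x_{πμ}`.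
* §2 **`virtual_core_rotate_sigma0`** — real chart = a free letter `π g` with the slot `π a` translated away: the virtual partner steps in
  the chart of `a` and the bijection becomes `π′ = π ∘ (a g)`.
[cite: Hauser2010, §§F–G] [cite: CossartJannsenSaito2020, Thm. 3.14] [cite: HauserPerlega2019PRIMS, §2]
bears_on: LADDER-RESOLUTION:D157-DOOR2 (res-dim4-pi · K2(p) B-LF (iii-b) class (iii) virtual port C1).  Supports
stmt-ResolutionOfSingularities-16155 (helper).
-/

set_option linter.dupNamespace false -- mandated namespace of this single-conjunct summit

noncomputable section

namespace Summit.ResolutionOfSingularities.ResolutionOfSingularities.Theorems.PIDim4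

namespace SwapTransport

open MvPolynomial Finset
open Literature.AlgebraicGeometry.Resolution
open Literature.AlgebraicGeometry.Resolution.CentreBlowup
open Literature.AlgebraicGeometry.Resolution.Hauser2010
open Literature.AlgebraicGeometry.Resolution.HauserPerlega2019

variable {K : Type} [Field K] [DecidableEq K]


/-! ## §1 Slot case -/

/-- **TRANSPORT CORE — SLOT CASE, every σ = (n, n) + 0** (regime-free: any `e_G`; no frame; the virtual translation `b′` is RETURNED,
supported on the free letters; the pinning lemmas then show `b′ = 0`).  REAL state `A` (weights `n·x_{πλ} + n·x_{πμ}`, order `p + n`,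
`0 < n < p`) with its honest child `A′ = step p univ (π λ) b A` in the chart of the slot `π λ` (isolated with certificate level `Nc`,
order `p + n`, `e_G = eG`, weights of degree `2n`, `x^{r′} ∣ F′`); VIRTUAL state `B` (weights `n·x_λ + n·x_μ`, order `p + n`, `x^r ∣ F`)
related to `A` by a slot-unit-class frame `θ` along `π` at precision `M ≥ Nc + 2p + n + 1` with invertible free block.  THEN `b (π μ) = 0`,
`A′` keeps the twin weights, and the virtual child `step p univ λ b′ B` (Cramer translation `b′`, `b′ λ = b′ μ = 0`) is related to `A′`
along `π` at precision `M − p` with invertible free block, has order `p + n`, twin weights, `x^r ∣ F`, is isolated, and has `e_G = eG`.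
[OURS] [cite: Hauser2010, §§F–G] [cite: CossartJannsenSaito2020, Thm. 3.14] -/
theorem virtual_core_slot_sigma0 (p : ℕ) [Fact p.Prime] [CharP K p] {n : ℕ} (hn : 0 < n) (hnp : n < p) {π : Equiv.Perm (Fin 4)} {la mu u f : Fin 4}
    (hlm : la ≠ mu) (hlu : la ≠ u) (hlf : la ≠ f) (hmu : mu ≠ u) (hmf : mu ≠ f) (huf : u ≠ f)
    -- the relation at precision `M`
    {A B : State K} {θ e : Fin 4 → MvPolynomial (Fin 4) K} {U E : MvPolynomial (Fin 4) K} {M : ℕ}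
    (hθa : θ (π la) = X la * e la) (hθa' : θ (π mu) = X mu * e mu) (hea : constantCoeff (e la) ≠ 0)
    (hea' : constantCoeff (e mu) ≠ 0) (hu0 : constantCoeff (θ (π u)) = 0) (hf0 : constantCoeff (θ (π f)) = 0)
    (hdet : coeff (Finsupp.single u 1) (θ (π u)) * coeff (Finsupp.single f 1) (θ (π f)) -
      coeff (Finsupp.single f 1) (θ (π u)) * coeff (Finsupp.single u 1) (θ (π f)) ≠ 0)
    (hU : constantCoeff U ≠ 0) (hE : E ∈ originIdeal K ^ M) (hrel : B.F = deletePthPowers p (U ^ p * aeval θ A.F) + E)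
    -- the real state and its honest slot step
    (hoA : ordZero A.F = ((p + n : ℕ) : ℕ∞)) (hrA : A.r = Finsupp.single (π la) n + Finsupp.single (π mu) n) {A' : State K}
    {b : Fin 4 → K} (hbj : b (π la) = 0) (hstep : A' = CentreBlowup.step p Finset.univ (π la) b A)
    (hisoA' : IsIsolated p A'.F) {Nc : ℕ} (hcert : originIdeal K ^ Nc ≤ singLocusIdeal p A'.F ⊔ originIdeal K ^ (Nc + 1))
    (hoA' : ordZero A'.F = ((p + n : ℕ) : ℕ∞)) {eG : ℕ} (he3A' : Module.finrank K (ResCone.resVertex A') = eG)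
    (hdegA' : A'.r.degree = 2 * n) (hdivA' : ∀ d ∈ A'.F.support, A'.r ≤ d)
    -- the virtual state
    (hoB : ordZero B.F = ((p + n : ℕ) : ℕ∞)) (hrB : B.r = Finsupp.single la n + Finsupp.single mu n)
    (hdivB : ∀ d ∈ B.F.support, B.r ≤ d) (hM : Nc + 2 * p + n + 1 ≤ M) :
    b (π mu) = 0 ∧ A'.r = Finsupp.single (π la) n + Finsupp.single (π mu) n ∧
    ∃ (b' : Fin 4 → K) (θ' e' : Fin 4 → MvPolynomial (Fin 4) K) (U' E' : MvPolynomial (Fin 4) K),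
      b' la = 0 ∧ b' mu = 0 ∧
      θ' (π la) = X la * e' la ∧ θ' (π mu) = X mu * e' mu ∧ constantCoeff (e' la) ≠ 0 ∧ constantCoeff (e' mu) ≠ 0 ∧
      constantCoeff (θ' (π u)) = 0 ∧ constantCoeff (θ' (π f)) = 0 ∧
      coeff (Finsupp.single u 1) (θ' (π u)) * coeff (Finsupp.single f 1) (θ' (π f)) -
        coeff (Finsupp.single f 1) (θ' (π u)) * coeff (Finsupp.single u 1) (θ' (π f)) ≠ 0 ∧
      constantCoeff U' ≠ 0 ∧ E' ∈ originIdeal K ^ (M - p) ∧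
      (CentreBlowup.step p Finset.univ la b' B).F = deletePthPowers p (U' ^ p * aeval θ' A'.F) + E' ∧
      ordZero (CentreBlowup.step p Finset.univ la b' B).F = ((p + n : ℕ) : ℕ∞) ∧
      (CentreBlowup.step p Finset.univ la b' B).r = Finsupp.single la n + Finsupp.single mu n ∧
      (∀ d ∈ (CentreBlowup.step p Finset.univ la b' B).F.support, (CentreBlowup.step p Finset.univ la b' B).r ≤ d) ∧
      IsIsolated p (CentreBlowup.step p Finset.univ la b' B).F ∧
      Module.finrank K (ResCone.resVertex (CentreBlowup.step p Finset.univ la b' B)) = eG := by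
  have hp1 : 1 < p := (Fact.out : p.Prime).one_lt
  have hpo : ¬ p ∣ p + n := fun h => by
    have h' : p ∣ n := by simpa using (Nat.dvd_add_right (dvd_refl p)).mp h
    exact absurd (Nat.le_of_dvd hn h') (by omega)
  have hπlm : π la ≠ π mu := fun h => hlm (π.injective h)
  have hπlu : π la ≠ π u := fun h => hlu (π.injective h)
  have hπlf : π la ≠ π f := fun h => hlf (π.injective h)
  have hπmu : π mu ≠ π u := fun h => hmu (π.injective h)
  have hπmf : π mu ≠ π f := fun h => hmf (π.injective h)
  have hπuf : π u ≠ π f := fun h => huf (π.injective h)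
  -- (1) the kept slot: `b (π mu) = 0`, `A′.r = x_{πλ} x_{πμ}`
  have hdeg' : (CentreBlowup.step p Finset.univ (π la) b A).r.degree = 2 * n := by rw [← hstep]; exact hdegA'
  have hkept : b (π mu) = 0 ∧ A'.r = Finsupp.single (π la) n + Finsupp.single (π mu) n := by
    rcases step_cases_of_weights_sigma0 p hn hπlm hπlu hπlf hπmu hπmf hπuf hrA hoA (jr := π la) hdeg' with
      ⟨-, hb, hr⟩ | ⟨h, -⟩ | ⟨h, -⟩
    · exact ⟨hb, by rw [hstep, hr]⟩
    · exact absurd h hπlm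
    · rcases h with h | h
      · exact absurd h hπlu
      · exact absurd h hπlf
  obtain ⟨hbmu, hrA'⟩ := hkept
  -- (2) the class hypotheses in `∀ i ∉ {u, f}` form
  have hslots : ∀ i : Fin 4, i ≠ u → i ≠ f → i = la ∨ i = mu := by
    intro i hiu hif
    rcases ResCone.letters_exhaust hlm hlu hlf hmu hmf huf i with h | h | h | h
    · exact Or.inl h
    · exact Or.inr h
    · exact absurd h hiu
    · exact absurd h hif
  have hθi : ∀ i, i ≠ u → i ≠ f → θ (π i) = X i * e i := by
    intro i hiu hif; rcases hslots i hiu hif with rfl | rfl <;> assumption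
  have he : ∀ i, i ≠ u → i ≠ f → constantCoeff (e i) ≠ 0 := by
    intro i hiu hif; rcases hslots i hiu hif with rfl | rfl <;> assumption
  have hbi : ∀ i, i ≠ u → i ≠ f → b (π i) = 0 := by
    intro i hiu hif; rcases hslots i hiu hif with rfl | rfl <;> assumption
  -- (3) Cramer: the virtual translation
  obtain ⟨b', hb'i, hγu, hγf⟩ := exists_virtual_translation_step (π := π) (θ := θ) (e := e) la huf b hdet
  have hA5 : ((p : ℕ) : ℕ∞) ≤ ordAlong Finset.univ A.F := by
    rw [ordAlong_univ, hoA]; exact_mod_cast (by omega : p ≤ p + n)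
  have hB5 : ((p : ℕ) : ℕ∞) ≤ ordAlong Finset.univ B.F := by
    rw [ordAlong_univ, hoB]; exact_mod_cast (by omega : p ≤ p + n)
  -- (4) transport
  obtain ⟨θ', e', U', E', w, hθ'i, he', hu0', hf0', hU', hE', hrel', hwc, -, -, hlinu, hlinf⟩ :=
    unitFrame_step₂ p π huf hθi he hu0 hf0 hU hE hrel hA5 hB5 hlu hlf hbi hb'i hγu hγf
  rw [← hstep] at hrel'
  have hwne : w ≠ 0 := left_ne_zero_of_mul_eq_one hwc
  -- (5) the new free block is invertible
  have hdet' : coeff (Finsupp.single u 1) (θ' (π u)) * coeff (Finsupp.single f 1) (θ' (π f)) -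
      coeff (Finsupp.single f 1) (θ' (π u)) * coeff (Finsupp.single u 1) (θ' (π f)) ≠ 0 := by
    rw [det_after_step hlu hlf hlinu hlinf]
    exact mul_ne_zero (pow_ne_zero 2 hwne) hdet
  -- (6) order and isolation of the virtual child
  have hread := read_of_rel₂ p hlm hlu hlf hmu hmf huf (hθ'i la hlu hlf) (hθ'i mu hmu hmf) (he' la hlu hlf)
    (he' mu hmu hmf) hu0' hf0' hdet' hU' hE' hrel' hisoA' hcert (by omega) (o := p + n) hoA'
    hpo (by omega)
  have hisoBp : IsIsolated p (CentreBlowup.step p Finset.univ la b' B).F := hread.1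
  have hoBp : ordZero (CentreBlowup.step p Finset.univ la b' B).F = ((p + n : ℕ) : ℕ∞) := hread.2
  -- (7) ledger and divisibility of the virtual child, then `e_G` by the transfer
  have hb'la : b' la = 0 := hb'i la hlu hlf
  have hb'mu : b' mu = 0 := hb'i mu hmu hmf
  have hrBp : (CentreBlowup.step p Finset.univ la b' B).r = Finsupp.single la n + Finsupp.single mu n :=
    step_r_pair_of_slot_sigma0 p hlm hlu hlf hmu hmf huf hrB hoB hb'mu
  have hdivBp : ∀ d ∈ (CentreBlowup.step p Finset.univ la b' B).F.support, (CentreBlowup.step p Finset.univ la b' B).r ≤ d :=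
    forall_le_step_gen B hdivB la hb'la
  have he3Bp : Module.finrank K (ResCone.resVertex (CentreBlowup.step p Finset.univ la b' B)) = eG := by
    rw [eG_transfer_sigma0 p hlm hlu hlf hmu hmf huf (A := A') (B := CentreBlowup.step p Finset.univ la b' B) (hθ'i la hlu hlf)
      (hθ'i mu hmu hmf) (he' la hlu hlf) (he' mu hmu hmf) hu0' hf0' hdet' hU' hE' hrel' hrA' hrBp hdivA' hoA'
      hpo (by omega)]
    exact he3A'
  exact ⟨hbmu, hrA', b', θ', e', U', E', hb'la, hb'mu, hθ'i la hlu hlf, hθ'i mu hmu hmf, he' la hlu hlf, he' mu hmu hmf, hu0', hf0',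
    hdet', hU', hE', hrel', hoBp, hrBp, hdivBp, hisoBp, he3Bp⟩

/-! ## §2 Rotation case -/

/-- **TRANSPORT CORE — ROTATION CASE, every σ = (n, n) + 0** (regime-free; the virtual translation `b′` off the slots is RETURNED).
The real chain steps in the chart of a FREE letter `π g` translating the slot `π a` away (`b (π a) ≠ 0`, `b (π a′) = 0`, child weights
`n·x_{πg} + n·x_{πa′}`); the virtual partner steps in the chart of `a` and the bijection becomes `π′ = π ∘ (a g)`. [OURS]
[cite: Hauser2010, §§F–G] [cite: CossartJannsenSaito2020, Thm. 3.14] -/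
theorem virtual_core_rotate_sigma0 (p : ℕ) [Fact p.Prime] [CharP K p] {n : ℕ} (hn : 0 < n) (hnp : n < p) {π : Equiv.Perm (Fin 4)} {a a' u f g gt : Fin 4}
    (haa' : a ≠ a') (hau : a ≠ u) (haf : a ≠ f) (ha'u : a' ≠ u) (ha'f : a' ≠ f) (huf : u ≠ f)
    (hg : (g = u ∧ gt = f) ∨ (g = f ∧ gt = u))
    -- the relation at precision `M`
    {A B : State K} {θ e : Fin 4 → MvPolynomial (Fin 4) K} {U E : MvPolynomial (Fin 4) K} {M : ℕ}
    (hθa : θ (π a) = X a * e a) (hθa' : θ (π a') = X a' * e a') (hea : constantCoeff (e a) ≠ 0)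
    (hea' : constantCoeff (e a') ≠ 0) (hu0 : constantCoeff (θ (π u)) = 0) (hf0 : constantCoeff (θ (π f)) = 0)
    (hdet : coeff (Finsupp.single u 1) (θ (π u)) * coeff (Finsupp.single f 1) (θ (π f)) -
      coeff (Finsupp.single f 1) (θ (π u)) * coeff (Finsupp.single u 1) (θ (π f)) ≠ 0)
    (hU : constantCoeff U ≠ 0) (hE : E ∈ originIdeal K ^ M) (hrel : B.F = deletePthPowers p (U ^ p * aeval θ A.F) + E)
    -- the real state and its honest rotation step
    (hoA : ordZero A.F = ((p + n : ℕ) : ℕ∞)) {A' : State K} {b : Fin 4 → K} (hbj : b (π g) = 0) (hba : b (π a) ≠ 0)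
    (hba' : b (π a') = 0) (hstep : A' = CentreBlowup.step p Finset.univ (π g) b A)
    (hisoA' : IsIsolated p A'.F) {Nc : ℕ} (hcert : originIdeal K ^ Nc ≤ singLocusIdeal p A'.F ⊔ originIdeal K ^ (Nc + 1))
    (hoA' : ordZero A'.F = ((p + n : ℕ) : ℕ∞)) {eG : ℕ} (he3A' : Module.finrank K (ResCone.resVertex A') = eG)
    (hrA' : A'.r = Finsupp.single (π g) n + Finsupp.single (π a') n) (hdivA' : ∀ d ∈ A'.F.support, A'.r ≤ d)
    -- the virtual state
    (hoB : ordZero B.F = ((p + n : ℕ) : ℕ∞)) (hrB : B.r = Finsupp.single a n + Finsupp.single a' n)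
    (hdivB : ∀ d ∈ B.F.support, B.r ≤ d) (hM : Nc + 2 * p + n + 1 ≤ M) :
    ∃ (π' : Equiv.Perm (Fin 4)) (b' : Fin 4 → K) (θ' e' : Fin 4 → MvPolynomial (Fin 4) K) (U' E' : MvPolynomial (Fin 4) K),
      π' = (Equiv.swap a g).trans π ∧ π' a = π g ∧ π' a' = π a' ∧ π' g = π a ∧ π' gt = π gt ∧ b' a = 0 ∧ b' a' = 0 ∧
      θ' (π' a) = X a * e' a ∧ θ' (π' a') = X a' * e' a' ∧ constantCoeff (e' a) ≠ 0 ∧ constantCoeff (e' a') ≠ 0 ∧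
      constantCoeff (θ' (π' u)) = 0 ∧ constantCoeff (θ' (π' f)) = 0 ∧
      coeff (Finsupp.single u 1) (θ' (π' u)) * coeff (Finsupp.single f 1) (θ' (π' f)) -
        coeff (Finsupp.single f 1) (θ' (π' u)) * coeff (Finsupp.single u 1) (θ' (π' f)) ≠ 0 ∧
      constantCoeff U' ≠ 0 ∧ E' ∈ originIdeal K ^ (M - p) ∧
      (CentreBlowup.step p Finset.univ a b' B).F = deletePthPowers p (U' ^ p * aeval θ' A'.F) + E' ∧
      ordZero (CentreBlowup.step p Finset.univ a b' B).F = ((p + n : ℕ) : ℕ∞) ∧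
      (CentreBlowup.step p Finset.univ a b' B).r = Finsupp.single a n + Finsupp.single a' n ∧
      (∀ d ∈ (CentreBlowup.step p Finset.univ a b' B).F.support, (CentreBlowup.step p Finset.univ a b' B).r ≤ d) ∧
      IsIsolated p (CentreBlowup.step p Finset.univ a b' B).F ∧
      Module.finrank K (ResCone.resVertex (CentreBlowup.step p Finset.univ a b' B)) = eG := by
  have hp1 : 1 < p := (Fact.out : p.Prime).one_lt
  have hpo : ¬ p ∣ p + n := fun h => by
    have h' : p ∣ n := by simpa using (Nat.dvd_add_right (dvd_refl p)).mp h
    exact absurd (Nat.le_of_dvd hn h') (by omega)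
  -- (1) the free letters `g, g̃`
  have hag : a ≠ g := by rcases hg with ⟨rfl, -⟩ | ⟨rfl, -⟩ <;> assumption
  have hagt : a ≠ gt := by rcases hg with ⟨-, rfl⟩ | ⟨-, rfl⟩ <;> assumption
  have ha'g : a' ≠ g := by rcases hg with ⟨rfl, -⟩ | ⟨rfl, -⟩ <;> assumption
  have ha'gt : a' ≠ gt := by rcases hg with ⟨-, rfl⟩ | ⟨-, rfl⟩ <;> assumption
  have hggt : g ≠ gt := by
    rcases hg with ⟨rfl, rfl⟩ | ⟨rfl, rfl⟩
    · exact huf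
    · exact huf.symm
  have hg0 : constantCoeff (θ (π g)) = 0 := by rcases hg with ⟨rfl, -⟩ | ⟨rfl, -⟩ <;> assumption
  have hgt0 : constantCoeff (θ (π gt)) = 0 := by rcases hg with ⟨-, rfl⟩ | ⟨-, rfl⟩ <;> assumption
  have hdetg : coeff (Finsupp.single g 1) (θ (π g)) * coeff (Finsupp.single gt 1) (θ (π gt)) -
      coeff (Finsupp.single gt 1) (θ (π g)) * coeff (Finsupp.single g 1) (θ (π gt)) ≠ 0 := by
    rcases hg with ⟨rfl, rfl⟩ | ⟨rfl, rfl⟩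
    · exact hdet
    · exact fun h => hdet (by linear_combination h)
  have hA5 : ((p : ℕ) : ℕ∞) ≤ ordAlong Finset.univ A.F := by
    rw [ordAlong_univ, hoA]; exact_mod_cast (by omega : p ≤ p + n)
  have hB5 : ((p : ℕ) : ℕ∞) ≤ ordAlong Finset.univ B.F := by
    rw [ordAlong_univ, hoB]; exact_mod_cast (by omega : p ≤ p + n)
  -- (2) Cramer: the virtual translation and the rescaling `λ`
  obtain ⟨lam, b', hb'a, hb'a', hLa, hLg, hLgt⟩ :=
    exists_virtual_translation_rotate (π := π) (θ := θ) (e := e) hag hagt ha'g ha'gt hggt b hba hdetg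
  have hlam : lam ≠ 0 := by
    intro h; rw [h, zero_mul] at hLa; exact hea hLa.symm
  -- (3) transport across the two charts
  obtain ⟨θ', e', U', E', hθ'g, hθ'a', he'a, he'a', ha0', hgt0', hU', hE', hrel', -, -, htana, htangt⟩ :=
    unitFrame_rotate₂ p π haa' hag hagt ha'g ha'gt hggt (M := M) (by omega) hθa hθa' hea hea' hg0 hgt0 hU hE hrel hA5 hB5
      hbj hba' hb'a hb'a' hLa hLg hLgt
  rw [← hstep] at hrel'
  -- (4) the new free block is invertible
  have hD'g : coeff (Finsupp.single g 1) (θ' (π a)) * coeff (Finsupp.single gt 1) (θ' (π gt)) -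
      coeff (Finsupp.single gt 1) (θ' (π a)) * coeff (Finsupp.single g 1) (θ' (π gt)) ≠ 0 := by
    intro h0
    have h := det_after_rotate hag hagt (σ := b (π gt)) hlam htana htangt
    rw [h0, mul_zero] at h
    exact mul_ne_zero hea hdetg (neg_eq_zero.mp h.symm)
  -- (5) the new bijection `π′ = π ∘ (a g)`
  obtain ⟨π', hπ'⟩ : ∃ π' : Equiv.Perm (Fin 4), π' = (Equiv.swap a g).trans π := ⟨_, rfl⟩
  have hπ'a : π' a = π g := by rw [hπ', Equiv.trans_apply, Equiv.swap_apply_left]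
  have hπ'g : π' g = π a := by rw [hπ', Equiv.trans_apply, Equiv.swap_apply_right]
  have hπ'a' : π' a' = π a' := by rw [hπ', Equiv.trans_apply, Equiv.swap_apply_of_ne_of_ne haa'.symm ha'g]
  have hπ'gt : π' gt = π gt := by rw [hπ', Equiv.trans_apply, Equiv.swap_apply_of_ne_of_ne hagt.symm hggt.symm]
  have hθn : θ' (π' a) = X a * e' a := by rw [hπ'a]; exact hθ'g
  have hθn' : θ' (π' a') = X a' * e' a' := by rw [hπ'a']; exact hθ'a'
  have hu0n : constantCoeff (θ' (π' u)) = 0 := by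
    rcases hg with ⟨rfl, rfl⟩ | ⟨rfl, rfl⟩
    · rw [hπ'g]; exact ha0'
    · rw [hπ'gt]; exact hgt0'
  have hf0n : constantCoeff (θ' (π' f)) = 0 := by
    rcases hg with ⟨rfl, rfl⟩ | ⟨rfl, rfl⟩
    · rw [hπ'gt]; exact hgt0'
    · rw [hπ'g]; exact ha0'
  have hdetn : coeff (Finsupp.single u 1) (θ' (π' u)) * coeff (Finsupp.single f 1) (θ' (π' f)) -
      coeff (Finsupp.single f 1) (θ' (π' u)) * coeff (Finsupp.single u 1) (θ' (π' f)) ≠ 0 := by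
    rcases hg with ⟨rfl, rfl⟩ | ⟨rfl, rfl⟩
    · rw [hπ'g, hπ'gt]; exact hD'g
    · rw [hπ'g, hπ'gt]; exact fun h => hD'g (by linear_combination h)
  have hrAn : A'.r = Finsupp.single (π' a) n + Finsupp.single (π' a') n := by rw [hπ'a, hπ'a']; exact hrA'
  -- (6) order and isolation of the virtual child
  have hread := read_of_rel₂ p haa' hau haf ha'u ha'f huf hθn hθn' he'a he'a' hu0n hf0n hdetn hU' hE' hrel' hisoA' hcert
    (by omega) (o := p + n) hoA' hpo (by omega)
  have hisoBp : IsIsolated p (CentreBlowup.step p Finset.univ a b' B).F := hread.1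
  have hoBp : ordZero (CentreBlowup.step p Finset.univ a b' B).F = ((p + n : ℕ) : ℕ∞) := hread.2
  -- (7) ledger and divisibility of the virtual child, then `e_G` by the transfer
  have hrBp : (CentreBlowup.step p Finset.univ a b' B).r = Finsupp.single a n + Finsupp.single a' n :=
    step_r_pair_of_slot_sigma0 p haa' hau haf ha'u ha'f huf hrB hoB hb'a'
  have hdivBp : ∀ d ∈ (CentreBlowup.step p Finset.univ a b' B).F.support, (CentreBlowup.step p Finset.univ a b' B).r ≤ d :=
    forall_le_step_gen B hdivB a hb'a
  have he3Bp : Module.finrank K (ResCone.resVertex (CentreBlowup.step p Finset.univ a b' B)) = eG := by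
    rw [eG_transfer_sigma0 p haa' hau haf ha'u ha'f huf (π := π') (A := A') (B := CentreBlowup.step p Finset.univ a b' B) hθn hθn'
      he'a he'a' hu0n hf0n hdetn hU' hE' hrel' hrAn hrBp hdivA' hoA' hpo (by omega)]
    exact he3A'
  exact ⟨π', b', θ', e', U', E', hπ', hπ'a, hπ'a', hπ'g, hπ'gt, hb'a, hb'a', hθn, hθn', he'a, he'a', hu0n, hf0n, hdetn, hU',
    hE', hrel', hoBp, hrBp, hdivBp, hisoBp, he3Bp⟩

end SwapTransport

end Summit.ResolutionOfSingularities.ResolutionOfSingularities.Theorems.PIDim4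

end
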